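import Mathlib

/-!
# Hodge-locus census (cell `pub-hlocus`, ENGINE A, gen 46) — the square-unit step behind the ramified
cell's Hilbert-symbol hypothesis, via Hensel's lemma in `ℤ_[p]`

certified instances and evidence bearing on the general Hodge conjecture; no claim.

GENERAL, DEFINITION-FREE lemma sheet (no census data).  In the accepted sheets
`HodgeLocusLVValuationCases.lean` (Part H) / `HodgeLocusLVRamifiedGuard.lean` the (R)-law of the cell's
three-cell term-wise law (DERIVATION-GK-A.md §5af Lemma 4) is proved from a HYPOTHESIS `hsq`: no nonzero
core term `a·m_x + X_x² = D` lies in "case 1", `2·v_ℓ(X_x) < v_ℓ(D)`.  §5af's reason is a two-step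
argument: (1) in case 1, `−a·m_x = X_x² − D = X_x²(1 − D/X_x²)` with `1 − D/X_x²` an `ℓ`-adic unit
`≡ 1 (mod ℓ)` (resp. `(mod 8)` at `ℓ = 2`), hence an `ℓ`-adic SQUARE; (2) therefore the Hilbert symbol
`(d₁, −a·m_x)_ℓ = +1`, whereas a nonzero term needs `−1` (Lemma 2, product formula) — so the term vanishes.
THIS FILE makes step (1) a kernel theorem, using Mathlib's `hensels_lemma` for `ℤ_[p]`:
* `isSquare_sq_sub` — `x, D : ℤ_[p]`, `‖D‖ < ‖2x‖²` ⇒ `IsSquare (x² − D)`; `isSquare_one_sub` — the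
  one-unit form `‖u‖ < ‖2‖² ⇒ IsSquare (1 − u)`;
* `isSquare_sq_sub_of_lt` (`p ≠ 2`: `x ≠ 0`, `2·v_p(x) < v_p(D)`, stated with `Nat.factorization` as in
  the sheets) and `isSquare_sq_sub_two_of_le` (`p = 2`: `2·v₂(x) + 3 ≤ v₂(D)`) ⇒ `IsSquare ((x:ℤ_[p])² − D)`;
* shape forms `isSquare_neg_mul_of_lt`, `isSquare_neg_mul_two_of_le` (`a·m + x² = D` in case 1 ⇒
  `−(a·m)` is a square in `ℤ_[p]`) and `isSquare_neg_of_four_mul` (`a = 4`: then `−m` is a square in `ℚ_[p]`);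
* norm bookkeeping `norm_natCast_le_of_pow_dvd`, `norm_natCast_ge_of_not_pow_dvd`, `norm_two_two`.
NOT formalised (stays a hypothesis of the other sheets): step (2) — Mathlib has no Hilbert symbol — and
Lemma 2 itself; nothing here identifies ENGINE A's code objects with these shapes; nothing on the truth
side ([cite: LauterViray2015SingularModuli, Thm. 1.5]; the local structure being transcribed is that of
[cite: GrossZagier1985SingularModuli, Thm. 1.3]).  No internally-minted statement is cited as a fact.
No `sorry`, no new axioms, no definitions.
-/

namespace Summit.HodgeConjecture.HodgeConjecture.HodgeLocus.Census.LVUnitSquare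

open Polynomial

set_option linter.dupNamespace false

variable {p : ℕ} [Fact p.Prime]

/-- HENSEL STEP.  For `x, D : ℤ_[p]` with `‖D‖ < ‖2x‖²`, `x² − D` is a square in `ℤ_[p]`
(Newton/Hensel for `X² − (x² − D)` at `X = x`: residual `D`, derivative `2x`). -/
theorem isSquare_sq_sub (x D : ℤ_[p]) (h : ‖D‖ < ‖2 * x‖ ^ 2) : IsSquare (x ^ 2 - D) := by
  set F : Polynomial ℤ_[p] := X ^ 2 - C (x ^ 2 - D) with hF
  have h1 : F.aeval x = D := by simp [hF]
  have h2 : F.derivative.aeval x = 2 * x := by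
    rw [hF, derivative_sub, derivative_C, sub_zero, derivative_X_pow]
    simp
  have hnorm : ‖F.aeval x‖ < ‖F.derivative.aeval x‖ ^ 2 := by rw [h1, h2]; exact h
  obtain ⟨z, hz, -⟩ := hensels_lemma hnorm
  have hz' : z ^ 2 - (x ^ 2 - D) = 0 := by simpa [hF] using hz
  exact ⟨z, by rw [← pow_two]; linear_combination -hz'⟩

/-- ONE-UNITS: `‖u‖ < ‖2‖²` (i.e. `u ≡ 0 (mod p)` for odd `p`, `u ≡ 0 (mod 8)` for `p = 2`) ⇒ `1 − u` is a
square in `ℤ_[p]`. -/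
theorem isSquare_one_sub (u : ℤ_[p]) (hu : ‖u‖ < ‖(2 : ℤ_[p])‖ ^ 2) : IsSquare (1 - u) := by
  have h := isSquare_sq_sub (1 : ℤ_[p]) u (by simpa using hu)
  simpa using h


/-- `p^k ∣ n` ⇒ `‖(n : ℤ_[p])‖ ≤ p^{-k}`. -/
theorem norm_natCast_le_of_pow_dvd {n k : ℕ} (h : p ^ k ∣ n) : ‖(n : ℤ_[p])‖ ≤ (p : ℝ) ^ (-k : ℤ) := by
  have := (PadicInt.norm_int_le_pow_iff_dvd (p := p) (k := (n : ℤ)) (n := k)).2 (by exact_mod_cast h)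
  simpa using this

/-- `p^{k+1} ∤ n` ⇒ `p^{-k} ≤ ‖(n : ℤ_[p])‖` (discreteness of the norm). -/
theorem norm_natCast_ge_of_not_pow_dvd {n k : ℕ} (h : ¬ p ^ (k + 1) ∣ n) :
    (p : ℝ) ^ (-k : ℤ) ≤ ‖(n : ℤ_[p])‖ := by
  by_contra hlt
  rw [not_le, PadicInt.norm_lt_pow_iff_norm_le_pow_sub_one] at hlt
  have : ‖((n : ℤ) : ℤ_[p])‖ ≤ (p : ℝ) ^ (-(k + 1 : ℕ) : ℤ) := by
    have e : (-(k : ℤ) - 1) = (-(k + 1 : ℕ) : ℤ) := by push_cast; ring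
    rw [← e]; simpa using hlt
  rw [PadicInt.norm_int_le_pow_iff_dvd] at this
  exact h (by exact_mod_cast this)

/-- `‖(2 : ℤ_[2])‖ = 1/2`. -/
theorem norm_two_two : ‖(2 : ℤ_[2])‖ = (2 : ℝ)⁻¹ := by
  have := PadicInt.norm_p (p := 2)
  simpa using this

/-- ODD `ℓ` (here `p ≠ 2`), the sheets' "case 1": `x ≠ 0` and `2·v_p(x) < v_p(D)` ⇒ `x² − D` is a
square in `ℤ_[p]` (so `1 − D/x²` is a unit square).  In DERIVATION-GK-A.md §5af (R) this is the step
"`2v_ℓ(x) < v_ℓ(D)` ⇒ `−a·m_x = x² − D` is an `ℓ`-adic square ⇒ `(d₁, −a·m_x)_ℓ = +1`"; the last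
implication (the Hilbert symbol) is NOT formalised. -/
theorem isSquare_sq_sub_of_lt (hp : p ≠ 2) {x D : ℕ} (hx : x ≠ 0)
    (hlt : 2 * x.factorization p < D.factorization p) :
    IsSquare ((x : ℤ_[p]) ^ 2 - D) := by
  apply isSquare_sq_sub
  set n := x.factorization p with hn
  have hD : p ^ (2 * n + 1) ∣ D :=
    (pow_dvd_pow p (by omega : 2 * n + 1 ≤ D.factorization p)).trans (Nat.ordProj_dvd D p)
  have hxn : ¬ p ^ (n + 1) ∣ x := Nat.pow_succ_factorization_not_dvd hx Fact.out
  have h1 : ‖(D : ℤ_[p])‖ ≤ (p : ℝ) ^ (-(2 * n + 1 : ℕ) : ℤ) := norm_natCast_le_of_pow_dvd hD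
  have h2 : (p : ℝ) ^ (-n : ℤ) ≤ ‖(x : ℤ_[p])‖ := norm_natCast_ge_of_not_pow_dvd hxn
  have hp1 : (1 : ℝ) < p := by exact_mod_cast (Fact.out : p.Prime).one_lt
  have h2n : ‖(2 : ℤ_[p])‖ = 1 := by
    simpa using (PadicInt.norm_natCast_eq_one_iff (p := p) (n := 2)).2
      ((Nat.coprime_primes Fact.out Nat.prime_two).2 hp)
  rw [norm_mul, h2n, one_mul]
  calc ‖(D : ℤ_[p])‖ ≤ (p : ℝ) ^ (-(2 * n + 1 : ℕ) : ℤ) := h1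
    _ < (p : ℝ) ^ ((-n : ℤ) * 2) := zpow_lt_zpow_right₀ hp1 (by push_cast; omega)
    _ = ((p : ℝ) ^ (-n : ℤ)) ^ 2 := by rw [zpow_mul, zpow_ofNat]
    _ ≤ ‖(x : ℤ_[p])‖ ^ 2 := pow_le_pow_left₀ (zpow_nonneg (by positivity) _) h2 2

/-- `ℓ = 2`, case 1 with the `mod 8` margin: `x ≠ 0` and `2·v₂(x) + 3 ≤ v₂(D)` ⇒ `x² − D` is a square
in `ℤ_[2]` (`1 − D/x² ≡ 1 (mod 8)`). -/
theorem isSquare_sq_sub_two_of_le {x D : ℕ} (hx : x ≠ 0)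
    (hle : 2 * x.factorization 2 + 3 ≤ D.factorization 2) :
    IsSquare ((x : ℤ_[2]) ^ 2 - D) := by
  apply isSquare_sq_sub
  set n := x.factorization 2 with hn
  have hD : 2 ^ (2 * n + 3) ∣ D := (pow_dvd_pow 2 hle).trans (Nat.ordProj_dvd D 2)
  have hxn : ¬ 2 ^ (n + 1) ∣ x := Nat.pow_succ_factorization_not_dvd hx Nat.prime_two
  have h1 : ‖(D : ℤ_[2])‖ ≤ (2 : ℝ) ^ (-(2 * n + 3 : ℕ) : ℤ) := by
    simpa using norm_natCast_le_of_pow_dvd (p := 2) hD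
  have h2 : (2 : ℝ) ^ (-n : ℤ) ≤ ‖(x : ℤ_[2])‖ := by
    simpa using norm_natCast_ge_of_not_pow_dvd (p := 2) hxn
  rw [norm_mul, norm_two_two]
  calc ‖(D : ℤ_[2])‖ ≤ (2 : ℝ) ^ (-(2 * n + 3 : ℕ) : ℤ) := h1
    _ < (2 : ℝ) ^ ((-1 + -n : ℤ) * 2) := zpow_lt_zpow_right₀ (by norm_num) (by push_cast; omega)
    _ = ((2 : ℝ)⁻¹ * (2 : ℝ) ^ (-n : ℤ)) ^ 2 := by
          rw [zpow_mul, zpow_ofNat, zpow_add₀ (by norm_num : (2 : ℝ) ≠ 0), zpow_neg_one]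
    _ ≤ ((2 : ℝ)⁻¹ * ‖(x : ℤ_[2])‖) ^ 2 :=
          pow_le_pow_left₀ (by positivity) (mul_le_mul_of_nonneg_left h2 (by norm_num)) 2

/-- SHAPE FORM, `p ≠ 2`: a term `a·m + x² = D` in case 1 (`x ≠ 0`, `2·v_p(x) < v_p(D)`) has `−(a·m)` a
square in `ℤ_[p]`. -/
theorem isSquare_neg_mul_of_lt (hp : p ≠ 2) {a m x D : ℕ} (hx : x ≠ 0) (hxD : a * m + x ^ 2 = D)
    (hlt : 2 * x.factorization p < D.factorization p) :
    IsSquare (-((a * m : ℕ) : ℤ_[p])) := by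
  have h := isSquare_sq_sub_of_lt hp hx hlt
  have e : ((x : ℤ_[p]) ^ 2 - D) = -((a * m : ℕ) : ℤ_[p]) := by
    rw [← hxD]; push_cast; ring
  rwa [e] at h

/-- SHAPE FORM, `ℓ = 2`: `a·m + x² = D`, `x ≠ 0`, `2·v₂(x) + 3 ≤ v₂(D)` ⇒ `−(a·m)` is a square in `ℤ_[2]`. -/
theorem isSquare_neg_mul_two_of_le {a m x D : ℕ} (hx : x ≠ 0) (hxD : a * m + x ^ 2 = D)
    (hle : 2 * x.factorization 2 + 3 ≤ D.factorization 2) :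
    IsSquare (-((a * m : ℕ) : ℤ_[2])) := by
  have h := isSquare_sq_sub_two_of_le hx hle
  have e : ((x : ℤ_[2]) ^ 2 - D) = -((a * m : ℕ) : ℤ_[2]) := by
    rw [← hxD]; push_cast; ring
  rwa [e] at h

/-- The cell's `a = 4` (`4·m_x = d₁d₂ − x²`): `−4m` a square in `ℤ_[p]` ⇒ `−m` a square in `ℚ_[p]`
(the class of `−m_x` modulo squares, which is what a Hilbert symbol `(d₁, −m_x)_p` reads). -/
theorem isSquare_neg_of_four_mul {m : ℕ} (h : IsSquare (-((4 * m : ℕ) : ℤ_[p]))) :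
    IsSquare (-(m : ℚ_[p])) := by
  obtain ⟨z, hz⟩ := h
  refine ⟨(z : ℚ_[p]) / 2, ?_⟩
  have hz' : (-((4 * m : ℕ) : ℚ_[p])) = (z : ℚ_[p]) * z := by
    have := congrArg (fun t : ℤ_[p] => (t : ℚ_[p])) hz
    push_cast at this ⊢; exact this
  push_cast at hz'
  field_simp
  linear_combination hz'

end Summit.HodgeConjecture.HodgeConjecture.HodgeLocus.Census.LVUnitSquare
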